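import Literature.AlgebraicGeometry.Motives.HodgeNumberFamilySemicontinuity
import Literature.AlgebraicGeometry.HodgeTheory.HypersurfaceFamilyCoordinates
import Literature.Analysis.Calculus.AddHaarImageNullOfFinrankEq
import Mathlib.Geometry.Manifold.ContMDiff.Atlas
import Mathlib.MeasureTheory.Constructions.Pi
import Mathlib.MeasureTheory.Measure.Lebesgue.Complex
import HarnessLib

/-!
# Holomorphic coordinate maps on `S(ℂ)` send algebraic-chart-null sets to Lebesgue-null sets

Family `hodge` (and any consumer of the tree's algebraic charts), layer
`Literature/AlgebraicGeometry/Motives`. Theorems only (no definition, no named fact).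

SETTING. `S` a `ℂ`-scheme smooth of relative dimension `m` and locally of finite type; `S(ℂ)` carries
the atlas of holomorphic algebraic charts
`chartedSpaceOfCharts (ComplexPoints.algebraicChart S m) (ComplexPoints.mem_algebraicChart_source S m)`
(Serre, GAGA §2: `isManifold_algebraicChart`, `isAnalytification_algebraicChart`) — the atlas used by
`HodgeFrameOfRelativeForms.exists_weightFrames_of_relativeForms` and
`HypersurfaceFamilyTopFormFrames.exists_topFormFrame_familySpz`, whose chart `ψ` at `t₁` IS
`algebraicChart S m t₁` (restricted to `univ`). A «coordinate map» is `χ : S(ℂ) → ℂ^ι`,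
`Fintype.card ι = m`, whose coordinates are holomorphic (`MDifferentiable` for that atlas) — e.g. the
affine coordinates of a morphism `S ⟶ 𝔸^σ` (`mdifferentiable_affineCoords_map_comp` with the
analytification `id`), in particular the coefficient charts of the hypersurface families.

RESULTS.
* `volume_image_algebraicChart_symm_image_eq_zero` — for every `t₁` and every Lebesgue-null
  `Z ⊆ (algebraicChart S m t₁).target`, the set `χ((algebraicChart S m t₁)⁻¹ Z) ⊆ ℂ^ι` is
  Lebesgue-null: `χ ∘ chart⁻¹` is holomorphic on the chart target (`contMDiffOn_chart_symm`), hence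
  real-differentiable, and differentiable maps between real vector spaces of the same dimension
  `2m` preserve null sets (`addHaar_image_eq_zero_of_differentiableOn_of_finrank_eq`, Lee Prop. 6.5);
* `volume_image_eq_zero_of_subset_iUnion_algebraicChart_symm_image` — countable-union form: a subset of
  `S(ℂ)` covered by countably many such chart-null pieces has Lebesgue-null image under `χ`;
* `mdifferentiable_affineCoords_algebraicChart` — the coordinates of a morphism `g : S ⟶ 𝔸^σ_ℂ` are
  `MDifferentiable` for the algebraic atlas (the hypothesis of the two theorems, for such `χ`).

Written for prover-Ax's programme AE «ALMOST EVERY» (cell `hodge-nonav`): it is the measure-side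
transfer from «zero set of a non-trivial analytic function read in the algebraic chart» on the base of
a family to «Lebesgue-null set of coefficient vectors». Honest scope: pure transfer lemmas; nothing here
says anything about Hodge loci or HC.

## References

* [Lee2012] J. M. Lee, Introduction to Smooth Manifolds, 2nd ed. (2012), Prop. 6.5.
* [SerreGAGA1956] J.-P. Serre, Géométrie algébrique et géométrie analytique, Ann. Inst. Fourier 6
  (1956), §2 n°5 Prop. 2, n°6.
-/

noncomputable section

open MeasureTheory Module Set
open scoped Manifold ContDiff
open Literature.NumberTheory.Transcendental

namespace Literature.AlgebraicGeometry.Motives.ComplexPoints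

variable (S : SchemeOver ℂ) (m : ℕ) [AlgebraicGeometry.LocallyOfFiniteType S.hom]
  [AlgebraicGeometry.SmoothOfRelativeDimension m S.hom]
  {ι : Type} [Fintype ι]

/-- The real dimension of `ℂ^ι` is `2 · #ι`. [folklore] -/
private theorem finrank_real_pi_complex (κ : Type) [Fintype κ] :
    finrank ℝ (κ → ℂ) = 2 * Fintype.card κ := by
  rw [Module.finrank_pi_fintype, Finset.sum_const, Finset.card_univ, Complex.finrank_real_complex,
    smul_eq_mul, mul_comm]

/-- **A holomorphic coordinate map sends algebraic-chart-null sets to Lebesgue-null sets.** For `S`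
smooth of relative dimension `m`, locally of finite type over `ℂ`, the algebraic-chart atlas on `S(ℂ)`,
a map `χ : S(ℂ) → ℂ^ι` (`#ι = m`) with `MDifferentiable` coordinates, a point `t₁` and a Lebesgue-null
`Z` inside the target of the algebraic chart at `t₁`: `volume (χ '' (chart⁻¹ '' Z)) = 0`.
[cite: Lee2012, Prop. 6.5] [cite: SerreGAGA1956, §2 n°5 Prop. 2 and n°6] -/
theorem volume_image_algebraicChart_symm_image_eq_zero (hι : Fintype.card ι = m)
    (χ : ComplexPoints S → (ι → ℂ))
    (hχ : letI := chartedSpaceOfCharts (algebraicChart S m) (mem_algebraicChart_source S m)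
      ∀ i, MDifferentiable 𝓘(ℂ, Fin m → ℂ) 𝓘(ℂ, ℂ) fun t ↦ χ t i)
    (t₁ : ComplexPoints S) {Z : Set (Fin m → ℂ)} (hZ : Z ⊆ (algebraicChart S m t₁).target)
    (hZ0 : volume Z = 0) :
    volume (χ '' ((algebraicChart S m t₁).symm '' Z)) = 0 := by
  letI cs : ChartedSpace (Fin m → ℂ) (ComplexPoints S) :=
    chartedSpaceOfCharts (algebraicChart S m) (mem_algebraicChart_source S m)
  haveI : IsManifold 𝓘(ℂ, Fin m → ℂ) ω (ComplexPoints S) := isManifold_algebraicChart S m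
  -- the chart inverse is holomorphic on the chart target
  have hsymm : MDifferentiableOn 𝓘(ℂ, Fin m → ℂ) 𝓘(ℂ, Fin m → ℂ)
      (chartAt (Fin m → ℂ) t₁).symm (chartAt (Fin m → ℂ) t₁).target :=
    (contMDiffOn_chart_symm (I := 𝓘(ℂ, Fin m → ℂ)) (n := ω) (x := t₁)).mdifferentiableOn (by simp)
  have hchart : chartAt (Fin m → ℂ) t₁ = algebraicChart S m t₁ := rfl
  -- hence every coordinate of `χ ∘ chart⁻¹` is holomorphic there, and `χ ∘ chart⁻¹` is real-differentiable
  have hcoord : ∀ i, DifferentiableOn ℂ (fun z ↦ χ ((algebraicChart S m t₁).symm z) i)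
      (algebraicChart S m t₁).target := by
    intro i
    have h := (hχ i).comp_mdifferentiableOn hsymm
    rw [hchart] at h
    exact mdifferentiableOn_iff_differentiableOn.mp h
  have hdiff : DifferentiableOn ℝ (fun z ↦ χ ((algebraicChart S m t₁).symm z)) Z :=
    ((differentiableOn_pi.mpr hcoord).restrictScalars ℝ).mono hZ
  -- differentiable maps between real vector spaces of the same dimension preserve null sets
  have hdim : finrank ℝ (Fin m → ℂ) = finrank ℝ (ι → ℂ) := by
    rw [finrank_real_pi_complex, finrank_real_pi_complex, Fintype.card_fin, hι]
  rw [Set.image_image]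
  exact Literature.Analysis.Calculus.addHaar_image_eq_zero_of_differentiableOn_of_finrank_eq
    volume volume hdim hdiff hZ0

/-- **Countable-union form.** If `M ⊆ S(ℂ)` is covered by countably many pieces
`(algebraicChart S m (t n))⁻¹ (Z n)` with each `Z n` a Lebesgue-null subset of the corresponding chart
target, then `χ '' M` is Lebesgue-null in `ℂ^ι`. [cite: Lee2012, Prop. 6.5]
[cite: SerreGAGA1956, §2 n°5 Prop. 2 and n°6] -/
theorem volume_image_eq_zero_of_subset_iUnion_algebraicChart_symm_image (hι : Fintype.card ι = m)
    (χ : ComplexPoints S → (ι → ℂ))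
    (hχ : letI := chartedSpaceOfCharts (algebraicChart S m) (mem_algebraicChart_source S m)
      ∀ i, MDifferentiable 𝓘(ℂ, Fin m → ℂ) 𝓘(ℂ, ℂ) fun t ↦ χ t i)
    {N : Type*} [Countable N] (t : N → ComplexPoints S) (Z : N → Set (Fin m → ℂ))
    (hZ : ∀ n, Z n ⊆ (algebraicChart S m (t n)).target) (hZ0 : ∀ n, volume (Z n) = 0)
    {M : Set (ComplexPoints S)} (hM : M ⊆ ⋃ n, (algebraicChart S m (t n)).symm '' Z n) :
    volume (χ '' M) = 0 := by
  refine measure_mono_null ((image_mono hM).trans (image_iUnion (f := χ)).subset) ?_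
  exact measure_iUnion_null fun n =>
    volume_image_algebraicChart_symm_image_eq_zero S m hι χ hχ (t n) (hZ n) (hZ0 n)

/-- **Affine coordinates of a morphism `g : S ⟶ 𝔸^σ_ℂ` are holomorphic for the algebraic atlas of
`S(ℂ)`** (`mdifferentiable_affineCoords_map_comp` for the analytification `id`,
`isAnalytification_algebraicChart`): the hypothesis `hχ` of the two theorems above for coordinate maps
`χ t i = x_{e i}(g(t))`. [cite: SerreGAGA1956, §2 n°5 Prop. 2 and n°6] -/
theorem mdifferentiable_affineCoords_algebraicChart {σ : Type}
    (g : S ⟶ affineSpaceOver σ ℂ) (a : σ) :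
    letI := chartedSpaceOfCharts (algebraicChart S m) (mem_algebraicChart_source S m)
    MDifferentiable 𝓘(ℂ, Fin m → ℂ) 𝓘(ℂ, ℂ) fun t : ComplexPoints S ↦
      AlgPoints.affineCoords (AlgPoints.map g t) a := by
  letI cs : ChartedSpace (Fin m → ℂ) (ComplexPoints S) :=
    chartedSpaceOfCharts (algebraicChart S m) (mem_algebraicChart_source S m)
  exact Literature.AlgebraicGeometry.HodgeTheory.mdifferentiable_affineCoords_map_comp
    g (isAnalytification_algebraicChart S m) a

end Literature.AlgebraicGeometry.Motives.ComplexPoints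

end
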